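import Summits.Langlands.Langlands.Theorems.RationalPeriodQuarterAnalyticCoreCoord

/-!
# `AnalyticCore` (child 2 of the lens-1-g38 split of `RationalPeriodQuarter.SemiAnalyticRigidity`) — the charts at infinity

THE STEP AT `∞`.  Input (coordinate `u = (N t + 1)⁻¹`, `τ u = (1 - u)/(N u)`): `h (τ u) = u·G u + wpl u` for small
`u > 0` and `h (τ u) = -u·G u + wmi u` for small `u < 0` (`G u = g₀ ((1 - u)/N)` analytic at `0`, `w±` fractions), and
`Δh = A/B` cofinitely.  Reading `Δh` through both charts gives a fraction `ψpl = Λ` on `u > 0` and `ψmi = -Λ` on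
`u < 0` with the SAME analytic `Λ u = σ u · G (σ u) - u · G u` (`σ u = u/(1 + N u)` is `t ↦ t + 1`); rigidity of
rational identities through `u = 0` forces `ψpl = -ψmi` on both sides, i.e. `2·A/B = Δ(wpl + wmi)` at infinity, hence
(polynomial identity) everywhere: with the rational function `E := (Wpl + Wmi)/2` one gets `Δ(h - E) = 0` cofinitely
and `h - E = ±(u·G u + w u)` on the two charts, `w = (wpl - wmi)/2`.
-/

set_option linter.dupNamespace false

namespace Summit.Langlands.Langlands.Theorems

open Filter Set Topology Polynomial

/-- `Λ u = σ u · g₀ ((1 - σ u)/N) - u · g₀ ((1 - u)/N)` is real-analytic at `u = 0`. -/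
theorem anCore_Lambda_analyticAt (N : ℕ) (g₀ : ℝ → ℂ) (hg₀ : AnalyticAt ℝ g₀ ((1 : ℝ) / N)) :
    AnalyticAt ℝ (fun u : ℝ => (((u / (1 + (N : ℝ) * u) : ℝ)) : ℂ) * g₀ ((1 - u / (1 + (N : ℝ) * u)) / N) -
      (u : ℂ) * g₀ ((1 - u) / N)) 0 := by
  have hσ : AnalyticAt ℝ (fun u : ℝ => u / (1 + (N : ℝ) * u)) 0 :=
    analyticAt_id.div (analyticAt_const.add (analyticAt_const.mul analyticAt_id)) (by simp)
  have hG0 : AnalyticAt ℝ (fun v : ℝ => g₀ ((1 - v) / N)) 0 := by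
    have hin : AnalyticAt ℝ (fun v : ℝ => (1 - v) / (N : ℝ)) 0 := (analyticAt_const.sub analyticAt_id).div_const
    have := AnalyticAt.comp_of_eq (g := g₀) (f := fun v : ℝ => (1 - v) / (N : ℝ)) hg₀ hin (by simp)
    simpa [Function.comp_def] using this
  have hGσ : AnalyticAt ℝ (fun u : ℝ => g₀ ((1 - u / (1 + (N : ℝ) * u)) / N)) 0 := by
    have := AnalyticAt.comp_of_eq (g := fun v : ℝ => g₀ ((1 - v) / N)) (f := fun u : ℝ => u / (1 + (N : ℝ) * u))
      hG0 hσ (by simp)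
    simpa [Function.comp_def] using this
  have hofR : ∀ (φ : ℝ → ℝ) (x : ℝ), AnalyticAt ℝ φ x → AnalyticAt ℝ (fun u : ℝ => ((φ u : ℝ) : ℂ)) x := by
    intro φ x hφ
    have := (Complex.ofRealCLM.analyticAt (φ x)).comp hφ
    simpa [Function.comp_def] using this
  exact ((hofR _ 0 hσ).mul hGσ).sub ((hofR (fun u => u) 0 analyticAt_id).mul hG0)

/-- THE CHART IDENTITY AT INFINITY: `2·(A/B)∘τ = Δ^σ(w₊ + w₋)` on both punctured sides of `u = 0`
(see the module docstring; `τ u = (1-u)/(N u)`, `σ u = u/(1 + N u)`). -/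
theorem anCore_charts (N : ℕ) (hN : 0 < N) (h g₀ : ℝ → ℂ) (hg₀ : AnalyticAt ℝ g₀ ((1 : ℝ) / N))
    (δ₁ : ℝ) (hδ₁ : 0 < δ₁) (Pp Qp : ℂ[X])
    (hright : ∀ u : ℝ, 0 < u → u < δ₁ → Qp.eval (u : ℂ) ≠ 0 ∧
      h ((1 - u) / ((N : ℝ) * u)) = (u : ℂ) * g₀ ((1 - u) / N) + Pp.eval (u : ℂ) / Qp.eval (u : ℂ))
    (δ₂ : ℝ) (hδ₂ : 0 < δ₂) (Pm Qm : ℂ[X])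
    (hleft : ∀ u : ℝ, u < 0 → -δ₂ < u → Qm.eval (u : ℂ) ≠ 0 ∧
      h ((1 - u) / ((N : ℝ) * u)) = -(u : ℂ) * g₀ ((1 - u) / N) + Pm.eval (u : ℂ) / Qm.eval (u : ℂ))
    (A B : ℂ[X]) (hΔ : ∀ᶠ (t : ℝ) in Filter.cofinite, B.eval (t : ℂ) ≠ 0 ∧
      h (t + 1) - h t = A.eval (t : ℂ) / B.eval (t : ℂ)) :
    ∃ δS : ℝ, 0 < δS ∧ δS ≤ δ₁ ∧ δS ≤ δ₂ / 2 ∧ δS ≤ 1 / (2 * (N : ℝ)) ∧ ∀ u : ℝ, u ≠ 0 → |u| < δS →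
      Qp.eval (u : ℂ) ≠ 0 ∧ Qm.eval (u : ℂ) ≠ 0 ∧ Qp.eval (((u / (1 + (N : ℝ) * u) : ℝ)) : ℂ) ≠ 0 ∧
      Qm.eval (((u / (1 + (N : ℝ) * u) : ℝ)) : ℂ) ≠ 0 ∧ B.eval ((((1 - u) / ((N : ℝ) * u) : ℝ)) : ℂ) ≠ 0 ∧
      2 * (A.eval ((((1 - u) / ((N : ℝ) * u) : ℝ)) : ℂ) / B.eval ((((1 - u) / ((N : ℝ) * u) : ℝ)) : ℂ)) =
        (Pp.eval (((u / (1 + (N : ℝ) * u) : ℝ)) : ℂ) / Qp.eval (((u / (1 + (N : ℝ) * u) : ℝ)) : ℂ) -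
          Pp.eval (u : ℂ) / Qp.eval (u : ℂ)) +
        (Pm.eval (((u / (1 + (N : ℝ) * u) : ℝ)) : ℂ) / Qm.eval (((u / (1 + (N : ℝ) * u) : ℝ)) : ℂ) -
          Pm.eval (u : ℂ) / Qm.eval (u : ℂ)) := by
  have hN' : (0 : ℝ) < N := by exact_mod_cast hN
  have hNc : (N : ℂ) ≠ 0 := by exact_mod_cast hN.ne'
  -- names
  set τ : ℝ → ℝ := fun u => (1 - u) / ((N : ℝ) * u) with hτ
  set σ : ℝ → ℝ := fun u => u / (1 + (N : ℝ) * u) with hσ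
  set G : ℝ → ℂ := fun u => g₀ ((1 - u) / N) with hG
  set Λ : ℝ → ℂ := fun u => ((σ u : ℝ) : ℂ) * G (σ u) - (u : ℂ) * G u with hΛ
  -- polynomial nonvanishing
  have hQp0 : Qp ≠ 0 := by
    intro h0; have := (hright (δ₁ / 2) (by linarith) (by linarith)).1
    rw [h0, Polynomial.eval_zero] at this; exact this rfl
  have hQm0 : Qm ≠ 0 := by
    intro h0; have := (hleft (-(δ₂ / 2)) (by linarith) (by linarith)).1
    rw [h0, Polynomial.eval_zero] at this; exact this rfl
  obtain ⟨ζp, hζp, hQpζ⟩ := anCore_poly_punctured Qp hQp0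
  obtain ⟨ζm, hζm, hQmζ⟩ := anCore_poly_punctured Qm hQm0
  -- Möbius forms
  obtain ⟨Ar, Br, hr⟩ := anCore_mobius_frac 1 (-1) 0 N A B
  obtain ⟨Ps, Qs, hs⟩ := anCore_mobius_frac 0 1 1 N Pp Qp
  obtain ⟨Ps', Qs', hs'⟩ := anCore_mobius_frac 0 1 1 N Pm Qm
  have hmobτ : ∀ u : ℝ, (1 + (-1) * (u : ℂ)) / (0 + (N : ℂ) * u) = ((τ u : ℝ) : ℂ) := by
    intro u; simp only [hτ]; push_cast; ring
  have hmobσ : ∀ u : ℝ, (0 + 1 * (u : ℂ)) / (1 + (N : ℂ) * u) = ((σ u : ℝ) : ℂ) := by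
    intro u; simp only [hσ]; push_cast; ring
  obtain ⟨Np, Dp, hNDp⟩ := anCore_three_fractions Ar Br Ps Qs Pp Qp
  obtain ⟨Nm, Dm, hNDm⟩ := anCore_three_fractions Ar Br Ps' Qs' Pm Qm
  -- transfer of the `Δ` identity to both charts
  obtain ⟨δ₃, hδ₃, hΔR⟩ := anCore_transfer_right N hN hΔ
  obtain ⟨δ₄, hδ₄, hΔL⟩ := anCore_transfer_left N hN hΔ
  -- RIGHT chart: `ψpl = Λ` on `(0, δR)`
  set δR : ℝ := min δ₁ δ₃ with hδR
  have hδR0 : 0 < δR := lt_min hδ₁ hδ₃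
  have hR : ∀ u : ℝ, 0 < u → u < δR → Br.eval (u : ℂ) ≠ 0 ∧ Qs.eval (u : ℂ) ≠ 0 ∧ Qp.eval (u : ℂ) ≠ 0 ∧
      A.eval ((τ u : ℝ) : ℂ) / B.eval ((τ u : ℝ) : ℂ) = Ar.eval (u : ℂ) / Br.eval (u : ℂ) ∧
      Pp.eval ((σ u : ℝ) : ℂ) / Qp.eval ((σ u : ℝ) : ℂ) = Ps.eval (u : ℂ) / Qs.eval (u : ℂ) ∧
      Dp.eval (u : ℂ) ≠ 0 ∧ Λ u = Np.eval (u : ℂ) / Dp.eval (u : ℂ) := by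
    intro u hu0 hu
    have hu1 : u < δ₁ := lt_of_lt_of_le hu (min_le_left _ _)
    have hu3 : u < δ₃ := lt_of_lt_of_le hu (min_le_right _ _)
    obtain ⟨hσ0, hσle⟩ := anCore_sigma_pos N u hu0
    have h1N : 1 + (N : ℝ) * u ≠ 0 := by positivity
    obtain ⟨hτσ, hσne⟩ := anCore_sigma_identities N hN u hu0.ne' h1N
    obtain ⟨hQpu, hhu⟩ := hright u hu0 hu1
    obtain ⟨hQpσ, hhσ⟩ := hright (σ u) hσ0 (lt_of_le_of_lt hσle hu1)
    obtain ⟨hBτ, hΔτ⟩ := hΔR u hu0 hu3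
    have huc : (u : ℂ) ≠ 0 := by exact_mod_cast hu0.ne'
    have hden1 : (0 : ℂ) + (N : ℂ) * u ≠ 0 := by rw [zero_add]; exact mul_ne_zero hNc huc
    have hden2 : (1 : ℂ) + (N : ℂ) * u ≠ 0 := by exact_mod_cast h1N
    obtain ⟨hBr, hrfrac⟩ := hr (u : ℂ) hden1 (by rw [hmobτ]; exact hBτ)
    obtain ⟨hQs, hsfrac⟩ := hs (u : ℂ) hden2 (by rw [hmobσ]; exact hQpσ)
    rw [hmobτ] at hrfrac; rw [hmobσ] at hsfrac
    obtain ⟨hDp, h3⟩ := hNDp (u : ℂ) hBr hQs hQpu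
    refine ⟨hBr, hQs, hQpu, hrfrac, hsfrac, hDp, ?_⟩
    -- `Λ u = ψpl u`
    have hτσ' : τ (σ u) = τ u + 1 := hτσ
    have key : A.eval ((τ u : ℝ) : ℂ) / B.eval ((τ u : ℝ) : ℂ) - Pp.eval ((σ u : ℝ) : ℂ) / Qp.eval ((σ u : ℝ) : ℂ)
        + Pp.eval (u : ℂ) / Qp.eval (u : ℂ) = Λ u := by
      rw [← hΔτ]
      have e1 : h (τ u + 1) = ((σ u : ℝ) : ℂ) * G (σ u) + Pp.eval ((σ u : ℝ) : ℂ) / Qp.eval ((σ u : ℝ) : ℂ) := by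
        rw [← hτσ']; exact hhσ
      rw [e1, hhu]; simp only [hΛ, hG]; ring
    rw [← key, hrfrac, hsfrac, h3]
  -- LEFT chart: `ψmi = -Λ` on `(-δL, 0)`
  set δL : ℝ := min (δ₂ / 2) (min (1 / (2 * (N : ℝ))) δ₄) with hδL
  have hδL0 : 0 < δL := lt_min (by linarith) (lt_min (by positivity) hδ₄)
  have hL : ∀ u : ℝ, u < 0 → -δL < u → Br.eval (u : ℂ) ≠ 0 ∧ Qs'.eval (u : ℂ) ≠ 0 ∧ Qm.eval (u : ℂ) ≠ 0 ∧
      A.eval ((τ u : ℝ) : ℂ) / B.eval ((τ u : ℝ) : ℂ) = Ar.eval (u : ℂ) / Br.eval (u : ℂ) ∧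
      Pm.eval ((σ u : ℝ) : ℂ) / Qm.eval ((σ u : ℝ) : ℂ) = Ps'.eval (u : ℂ) / Qs'.eval (u : ℂ) ∧
      Dm.eval (u : ℂ) ≠ 0 ∧ -Λ u = Nm.eval (u : ℂ) / Dm.eval (u : ℂ) := by
    intro u hu0 hu
    have hd1 : δL ≤ δ₂ / 2 := min_le_left _ _
    have hd2 : δL ≤ 1 / (2 * (N : ℝ)) := le_trans (min_le_right _ _) (min_le_left _ _)
    have hd3 : δL ≤ δ₄ := le_trans (min_le_right _ _) (min_le_right _ _)
    obtain ⟨hσ0, hσge⟩ := anCore_sigma_neg N hN u hu0 (by linarith)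
    have h1N : 1 + (N : ℝ) * u ≠ 0 := by
      have : (N : ℝ) * (-(1 / (2 * (N : ℝ)))) ≤ (N : ℝ) * u := by gcongr; linarith
      have h2 : (N : ℝ) * (-(1 / (2 * (N : ℝ)))) = -(1 / 2) := by field_simp
      linarith
    obtain ⟨hτσ, hσne⟩ := anCore_sigma_identities N hN u hu0.ne h1N
    obtain ⟨hQmu, hhu⟩ := hleft u hu0 (by linarith)
    obtain ⟨hQmσ, hhσ⟩ := hleft (σ u) hσ0 (by linarith)
    obtain ⟨hBτ, hΔτ⟩ := hΔL u hu0 (by linarith)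
    have huc : (u : ℂ) ≠ 0 := by exact_mod_cast hu0.ne
    have hden1 : (0 : ℂ) + (N : ℂ) * u ≠ 0 := by rw [zero_add]; exact mul_ne_zero hNc huc
    have hden2 : (1 : ℂ) + (N : ℂ) * u ≠ 0 := by exact_mod_cast h1N
    obtain ⟨hBr, hrfrac⟩ := hr (u : ℂ) hden1 (by rw [hmobτ]; exact hBτ)
    obtain ⟨hQs', hsfrac⟩ := hs' (u : ℂ) hden2 (by rw [hmobσ]; exact hQmσ)
    rw [hmobτ] at hrfrac; rw [hmobσ] at hsfrac
    obtain ⟨hDm, h3⟩ := hNDm (u : ℂ) hBr hQs' hQmu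
    refine ⟨hBr, hQs', hQmu, hrfrac, hsfrac, hDm, ?_⟩
    have hτσ' : τ (σ u) = τ u + 1 := hτσ
    have key : A.eval ((τ u : ℝ) : ℂ) / B.eval ((τ u : ℝ) : ℂ) - Pm.eval ((σ u : ℝ) : ℂ) / Qm.eval ((σ u : ℝ) : ℂ)
        + Pm.eval (u : ℂ) / Qm.eval (u : ℂ) = -Λ u := by
      rw [← hΔτ]
      have e1 : h (τ u + 1) = -((σ u : ℝ) : ℂ) * G (σ u) + Pm.eval ((σ u : ℝ) : ℂ) / Qm.eval ((σ u : ℝ) : ℂ) := by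
        rw [← hτσ']; exact hhσ
      rw [e1, hhu]; simp only [hΛ, hG]; ring
    rw [← key, hrfrac, hsfrac, h3]
  -- reduce `ψ±` and run rigidity through `u = 0`
  have hDp0 : Dp ≠ 0 := by
    intro h0; have := (hR (δR / 2) (by linarith) (by linarith)).2.2.2.2.2.1
    rw [h0, Polynomial.eval_zero] at this; exact this rfl
  have hDm0 : Dm ≠ 0 := by
    intro h0; have := (hL (-(δL / 2)) (by linarith) (by linarith)).2.2.2.2.2.1
    rw [h0, Polynomial.eval_zero] at this; exact this rfl
  obtain ⟨Np', Dp', hDp', hnop, hredp⟩ := anCore_reduce Np Dp hDp0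
  obtain ⟨Nm', Dm', hDm', hnom, hredm⟩ := anCore_reduce Nm Dm hDm0
  have hΛan : AnalyticAt ℝ Λ 0 := by
    have := anCore_Lambda_analyticAt N g₀ hg₀
    simpa [hΛ, hσ, hG] using this
  obtain ⟨η, hη, hηball⟩ := Metric.eventually_nhds_iff.1 hΛan.eventually_analyticAt
  have hΛI : ∀ x ∈ Metric.ball (0 : ℝ) η, AnalyticAt ℝ Λ x := fun x hx => hηball (Metric.mem_ball.1 hx)
  have hΛI' : ∀ x ∈ Metric.ball (0 : ℝ) η, AnalyticAt ℝ (fun u => -Λ u) x := fun x hx => (hΛI x hx).neg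
  -- rigidity from the right point
  set ypl : ℝ := min η δR / 2 with hypl
  have hypl0 : 0 < ypl := by have := lt_min hη hδR0; positivity
  have hyplη : ypl < η := by have := min_le_left η δR; have := lt_min hη hδR0; linarith
  have hyplR : ypl < δR := by have := min_le_right η δR; have := lt_min hη hδR0; linarith
  have hrigpl := anCore_rigid Λ (Metric.ball 0 η) (convex_ball 0 η).isPreconnected hΛI Np' Dp' hnop ypl
    (by rw [Metric.mem_ball, Real.dist_eq, sub_zero, abs_of_pos hypl0]; exact hyplη)
    (by
      have hmem : Set.Ioo (0 : ℝ) δR ∈ 𝓝 ypl := isOpen_Ioo.mem_nhds ⟨hypl0, hyplR⟩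
      filter_upwards [hmem] with u hu
      obtain ⟨-, -, -, -, -, hDp, hΛu⟩ := hR u hu.1 hu.2
      obtain ⟨hDp'u, hfr⟩ := hredp (u : ℂ) hDp
      exact ⟨hDp'u, by rw [hΛu, hfr]⟩)
  -- rigidity from the left point
  set ymi : ℝ := -(min η δL / 2) with hymi
  have hymi0 : ymi < 0 := by have := lt_min hη hδL0; simp only [hymi]; linarith
  have hymiη : -η < ymi := by have := min_le_left η δL; have := lt_min hη hδL0; simp only [hymi]; linarith
  have hymiL : -δL < ymi := by have := min_le_right η δL; have := lt_min hη hδL0; simp only [hymi]; linarith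
  have hrigmi := anCore_rigid (fun u => -Λ u) (Metric.ball 0 η) (convex_ball 0 η).isPreconnected hΛI' Nm' Dm'
    hnom ymi (by rw [Metric.mem_ball, Real.dist_eq, sub_zero, abs_of_neg hymi0]; linarith)
    (by
      have hmem : Set.Ioo (-δL) (0 : ℝ) ∈ 𝓝 ymi := isOpen_Ioo.mem_nhds ⟨hymiL, hymi0⟩
      filter_upwards [hmem] with u hu
      obtain ⟨-, -, -, -, -, hDm, hΛu⟩ := hL u hu.2 hu.1
      obtain ⟨hDm'u, hfr⟩ := hredm (u : ℂ) hDm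
      exact ⟨hDm'u, by rw [hΛu, hfr]⟩)
  -- THE IDENTITY `2·A/B ∘ τ = Δ^σ (wpl + wmi)` on both punctured sides
  set δS : ℝ := min (min η (min δR δL)) (min (ζp / 2) (ζm / 2)) with hδS
  have hδS0 : 0 < δS := by
    refine lt_min (lt_min hη (lt_min hδR0 hδL0)) (lt_min (by linarith) (by linarith))
  have hS : ∀ u : ℝ, u ≠ 0 → |u| < δS →
      Qp.eval (u : ℂ) ≠ 0 ∧ Qm.eval (u : ℂ) ≠ 0 ∧ Qp.eval ((σ u : ℝ) : ℂ) ≠ 0 ∧ Qm.eval ((σ u : ℝ) : ℂ) ≠ 0 ∧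
      B.eval ((τ u : ℝ) : ℂ) ≠ 0 ∧
      2 * (A.eval ((τ u : ℝ) : ℂ) / B.eval ((τ u : ℝ) : ℂ)) =
        (Pp.eval ((σ u : ℝ) : ℂ) / Qp.eval ((σ u : ℝ) : ℂ) - Pp.eval (u : ℂ) / Qp.eval (u : ℂ)) +
        (Pm.eval ((σ u : ℝ) : ℂ) / Qm.eval ((σ u : ℝ) : ℂ) - Pm.eval (u : ℂ) / Qm.eval (u : ℂ)) := by
    intro u hu0 hu
    have hη' : |u| < η := lt_of_lt_of_le hu (le_trans (min_le_left _ _) (min_le_left _ _))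
    have hR' : |u| < δR := lt_of_lt_of_le hu (le_trans (min_le_left _ _) (le_trans (min_le_right _ _) (min_le_left _ _)))
    have hL' : |u| < δL := lt_of_lt_of_le hu (le_trans (min_le_left _ _) (le_trans (min_le_right _ _) (min_le_right _ _)))
    have hp' : |u| < ζp / 2 := lt_of_lt_of_le hu (le_trans (min_le_right _ _) (min_le_left _ _))
    have hm' : |u| < ζm / 2 := lt_of_lt_of_le hu (le_trans (min_le_right _ _) (min_le_right _ _))
    have hball : u ∈ Metric.ball (0 : ℝ) η := by rw [Metric.mem_ball, Real.dist_eq, sub_zero]; exact hη'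
    obtain ⟨hDp'u, hΛpl⟩ := hrigpl u hball
    obtain ⟨hDm'u, hΛmi⟩ := hrigmi u hball
    have hΛΛ : Np'.eval (u : ℂ) / Dp'.eval (u : ℂ) = -(Nm'.eval (u : ℂ) / Dm'.eval (u : ℂ)) := by
      rw [← hΛpl, ← hΛmi, neg_neg]
    have hd2 : δL ≤ 1 / (2 * (N : ℝ)) := le_trans (min_le_right _ _) (min_le_left _ _)
    rcases lt_or_gt_of_ne hu0 with hneg | hpos
    · -- u < 0
      have hu' : -δL < u := by rw [abs_of_neg hneg] at hL'; linarith
      obtain ⟨hBr, hQs', hQmu, hrfrac, hsfrac', hDm, hψmi⟩ := hL u hneg hu'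
      obtain ⟨hσ0, hσge⟩ := anCore_sigma_neg N hN u hneg (by linarith)
      have hσabs : |σ u| < ζp := by rw [abs_of_neg hσ0]; rw [abs_of_neg hneg] at hp'; linarith
      have hQpσ : Qp.eval ((σ u : ℝ) : ℂ) ≠ 0 := hQpζ (σ u) hσ0.ne hσabs
      have hQpu : Qp.eval (u : ℂ) ≠ 0 := hQpζ u hu0 (by linarith)
      have h1N : (1 : ℂ) + (N : ℂ) * u ≠ 0 := by
        have : 1 + (N : ℝ) * u ≠ 0 := by
          have : (N : ℝ) * (-(1 / (2 * (N : ℝ)))) ≤ (N : ℝ) * u := by gcongr; linarith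
          have h2 : (N : ℝ) * (-(1 / (2 * (N : ℝ)))) = -(1 / 2) := by field_simp
          linarith
        exact_mod_cast this
      obtain ⟨hQs, hsfrac⟩ := hs (u : ℂ) h1N (by rw [hmobσ]; exact hQpσ)
      rw [hmobσ] at hsfrac
      obtain ⟨hDp, h3⟩ := hNDp (u : ℂ) hBr hQs hQpu
      obtain ⟨-, hfrp⟩ := hredp (u : ℂ) hDp
      obtain ⟨-, hfrm⟩ := hredm (u : ℂ) hDm
      refine ⟨hQpu, hQmu, hQpσ, (hleft (σ u) hσ0 (by
        have : δL ≤ δ₂ / 2 := min_le_left _ _; linarith)).1, ?_, ?_⟩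
      · have := (hΔL u hneg (by
          have : δL ≤ δ₄ := le_trans (min_le_right _ _) (min_le_right _ _); linarith)).1
        exact this
      -- ψpl-formula u = Np/Dp = Np'/Dp' = -(Nm'/Dm') = -(Nm/Dm) = -ψmi-formula u
      have eψpl : A.eval ((τ u : ℝ) : ℂ) / B.eval ((τ u : ℝ) : ℂ) - Pp.eval ((σ u : ℝ) : ℂ) / Qp.eval ((σ u : ℝ) : ℂ)
          + Pp.eval (u : ℂ) / Qp.eval (u : ℂ) = Np'.eval (u : ℂ) / Dp'.eval (u : ℂ) := by
        rw [hrfrac, hsfrac, h3, hfrp]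
      have eψmi : A.eval ((τ u : ℝ) : ℂ) / B.eval ((τ u : ℝ) : ℂ) - Pm.eval ((σ u : ℝ) : ℂ) / Qm.eval ((σ u : ℝ) : ℂ)
          + Pm.eval (u : ℂ) / Qm.eval (u : ℂ) = Nm'.eval (u : ℂ) / Dm'.eval (u : ℂ) := by
        rw [hrfrac, hsfrac', (hNDm (u : ℂ) hBr hQs' hQmu).2, hfrm]
      linear_combination eψpl + eψmi + hΛΛ
    · -- u > 0
      have hu' : u < δR := by rw [abs_of_pos hpos] at hR'; exact hR'
      obtain ⟨hBr, hQs, hQpu, hrfrac, hsfrac, hDp, hψpl⟩ := hR u hpos hu'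
      obtain ⟨hσ0, hσle⟩ := anCore_sigma_pos N u hpos
      have hσabs : |σ u| < ζm := by rw [abs_of_pos hσ0]; rw [abs_of_pos hpos] at hm'; linarith
      have hQmσ : Qm.eval ((σ u : ℝ) : ℂ) ≠ 0 := hQmζ (σ u) hσ0.ne' hσabs
      have hQmu : Qm.eval (u : ℂ) ≠ 0 := hQmζ u hu0 (by linarith)
      have h1N : (1 : ℂ) + (N : ℂ) * u ≠ 0 := by
        have : 1 + (N : ℝ) * u ≠ 0 := by positivity
        exact_mod_cast this
      obtain ⟨hQs', hsfrac'⟩ := hs' (u : ℂ) h1N (by rw [hmobσ]; exact hQmσ)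
      rw [hmobσ] at hsfrac'
      obtain ⟨hDm, h3⟩ := hNDm (u : ℂ) hBr hQs' hQmu
      obtain ⟨-, hfrp⟩ := hredp (u : ℂ) hDp
      obtain ⟨-, hfrm⟩ := hredm (u : ℂ) hDm
      refine ⟨hQpu, hQmu, (hright (σ u) hσ0 (by
        have : δR ≤ δ₁ := min_le_left _ _; linarith)).1, hQmσ, ?_, ?_⟩
      · exact (hΔR u hpos (by have : δR ≤ δ₃ := min_le_right _ _; linarith)).1
      have eψmi : A.eval ((τ u : ℝ) : ℂ) / B.eval ((τ u : ℝ) : ℂ) - Pm.eval ((σ u : ℝ) : ℂ) / Qm.eval ((σ u : ℝ) : ℂ)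
          + Pm.eval (u : ℂ) / Qm.eval (u : ℂ) = Nm'.eval (u : ℂ) / Dm'.eval (u : ℂ) := by
        rw [hrfrac, hsfrac', h3, hfrm]
      have eψpl : A.eval ((τ u : ℝ) : ℂ) / B.eval ((τ u : ℝ) : ℂ) - Pp.eval ((σ u : ℝ) : ℂ) / Qp.eval ((σ u : ℝ) : ℂ)
          + Pp.eval (u : ℂ) / Qp.eval (u : ℂ) = Np'.eval (u : ℂ) / Dp'.eval (u : ℂ) := by
        rw [hrfrac, hsfrac, (hNDp (u : ℂ) hBr hQs hQpu).2, hfrp]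
      linear_combination eψpl + eψmi + hΛΛ
  have hS1 : δS ≤ δ₁ := le_trans (min_le_left _ _) (le_trans (min_le_right _ _) (le_trans (min_le_left _ _) (min_le_left _ _)))
  have hS2 : δS ≤ δ₂ / 2 := le_trans (min_le_left _ _) (le_trans (min_le_right _ _) (le_trans (min_le_right _ _) (min_le_left _ _)))
  have hS3 : δS ≤ 1 / (2 * (N : ℝ)) :=
    le_trans (min_le_left _ _) (le_trans (min_le_right _ _) (le_trans (min_le_right _ _)
      (le_trans (min_le_right _ _) (min_le_left _ _))))
  exact ⟨δS, hδS0, hS1, hS2, hS3, hS⟩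

end Summit.Langlands.Langlands.Theorems
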